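import Summits.AtomisticToContinuum.Crystallization.Theorems.HullExactificationCascadeHullBulkOptimalCut

/-!
# Route `HullExactificationCascade`, item `HullBulkOptimal` (stmt-AtomisticToContinuum-12090), II:
# bookkeeping of one matched window

Support file for the item `HullExactificationCascade.HullBulkOptimal`.  Deterministic lemmas about
ONE finite configuration `p : Fin N → ℝ³` (a translated ground state), ONE point set `X ⊆ ℝ³`
and a matching map `idx : ℝ³ → Fin N` which sends every point `w` of a finite window
`Wf = {w ∈ X : dist w c ≤ L + ρ + 1}` to a particle within `ε₁` of it (`2ε₁` below the
separations of `X` and `p`):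

* `exists_gap` — a finite window leaves a gap: some `g > 0` with no point of `X` at distance in
  `(L, L + g]` from `c`;
* `sum_near_le_sum_image_add` — the truncated site sum `Σ_{z ∈ N_y} V_LJ(|y − z|)` of a window point
  `y` is within `#N_y · ω` of the partial site energy `Σ_{k ∈ idx(N_y)} V_LJ(|p(idx y) − p k|)` of
  its match (`ω` a modulus of continuity of `V_LJ` on `[r, ρ + 1]` at scale `2ε₁`);
* `far_of_not_mem_image` — a particle which is neither the match of `y` nor the match of a
  `ρ`-neighbour of `y` is at distance `≥ ρ/2` from the match of `y` (two-way matching);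
* `image_eq_ball` — the particles in `B̄_{L+ε₁}(c)` are exactly the matches of the points of `X`
  in `B̄_L(c)`, once `2ε₁` is below the gap;
* `tsum_site_le_siteEnergy_add` — hence the site sum of `X` at `y` is at most the site energy
  of the match of `y` in `p` plus `(2ρ/r + 1)³ ω + (1/6) · 1024/(r³ (ρ/2)³)`.

All `[folklore]`.
-/

noncomputable section

namespace Summit.AtomisticToContinuum.Crystallization.Theorems.HullBulkOptimal

open scoped BigOperators Topology
open Filter Set Metric
open Literature.MathematicalPhysics.StatisticalMechanics
open Summit.AtomisticToContinuum.Crystallization.Theorems.CoarseGrains.Negative.PredicateAPI (E3)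

/-- **A finite window leaves a gap.** If every point of `X` within `L + b` of `c` (`b > 0`) lies
in the finite set `Wf`, there is `g > 0` such that no point of `X` has its distance to `c` in
`(L, L + g]`. [folklore] -/
theorem exists_gap (Wf : Finset E3) {X : Set E3} (c : E3) {L b : ℝ} (hb : 0 < b)
    (hmemW : ∀ w : E3, w ∈ X → dist w c ≤ L + b → w ∈ Wf) :
    ∃ g : ℝ, 0 < g ∧ ∀ s ∈ X, dist s c ≤ L + g → dist s c ≤ L := by
  classical
  set D : Finset E3 := Wf.filter fun w => L < dist w c with hD
  by_cases hDn : D.Nonempty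
  · obtain ⟨w₀, hw₀, hmin⟩ := D.exists_min_image (fun w => dist w c) hDn
    have hw₀L : L < dist w₀ c := (Finset.mem_filter.1 hw₀).2
    refine ⟨min b ((dist w₀ c - L) / 2), lt_min hb (by linarith), fun s hs hsd => ?_⟩
    by_contra hlt
    have hlt' := not_le.1 hlt
    have hsW : s ∈ Wf := hmemW s hs (by linarith [min_le_left b ((dist w₀ c - L) / 2)])
    have h := hmin s (Finset.mem_filter.2 ⟨hsW, hlt'⟩)
    linarith [min_le_right b ((dist w₀ c - L) / 2)]
  · refine ⟨b, hb, fun s hs hsd => ?_⟩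
    by_contra hlt
    exact hDn ⟨s, Finset.mem_filter.2 ⟨hmemW s hs hsd, not_le.1 hlt⟩⟩

variable {N : ℕ} {p : Fin N → E3} {X : Set E3}

/-- **Truncated site sum against the matched partial site energy.** With `X` and `p` both
`r`-separated, `idx` an `ε₁`-matching of the window `Wf ⊆ X` injective on `Wf`, and `ω` a
modulus of continuity of `V_LJ` on `[r, ρ + 1]` at scale `ε₀ ≥ 2ε₁` (`2ε₁ ≤ 1`): for `y ∈ Wf` and
a set `N_y ⊆ Wf` of points `z ≠ y` within `ρ` of `y`,
`Σ_{z ∈ N_y} V_LJ(|y − z|) ≤ Σ_{k ∈ idx(N_y)} V_LJ(|p(idx y) − p k|) + #N_y · ω`. [folklore] -/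
theorem sum_near_le_sum_image_add {r ρ ε₁ ε₀ ω : ℝ}
    (hsepX : ∀ a ∈ X, ∀ b ∈ X, a ≠ b → r ≤ dist a b)
    (hpsep : ∀ k l : Fin N, k ≠ l → r ≤ dist (p k) (p l))
    (hmod : ∀ s ∈ Set.Icc r (ρ + 1), ∀ t ∈ Set.Icc r (ρ + 1), dist s t ≤ ε₀ →
      dist (lennardJones s) (lennardJones t) ≤ ω)
    (hε₁ε₀ : 2 * ε₁ ≤ ε₀) (hε₁2 : 2 * ε₁ ≤ 1)
    {Wf : Finset E3} (hWX : ∀ w ∈ Wf, w ∈ X)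
    {idx : E3 → Fin N} (hidx : ∀ w ∈ Wf, dist (p (idx w)) w ≤ ε₁)
    (hinj : Set.InjOn idx (Wf : Set E3))
    {y : E3} (hyW : y ∈ Wf) {Ny : Finset E3} (hNyW : Ny ⊆ Wf)
    (hNy : ∀ z ∈ Ny, z ≠ y ∧ dist z y ≤ ρ) :
    ∑ z ∈ Ny, lennardJones (dist y z) ≤
      ∑ k ∈ Ny.image idx, lennardJones (dist (p (idx y)) (p k)) + Ny.card * ω := by
  classical
  have h2 : ∀ z ∈ Ny, lennardJones (dist y z) ≤
      lennardJones (dist (p (idx y)) (p (idx z))) + ω := by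
    intro z hz
    obtain ⟨hzy, hzρ⟩ := hNy z hz
    have hzW : z ∈ Wf := hNyW hz
    have hne : idx y ≠ idx z := fun h => hzy (hinj hyW hzW h).symm
    have hd1 : r ≤ dist y z := hsepX y (hWX y hyW) z (hWX z hzW) (Ne.symm hzy)
    have hd2 : dist y z ≤ ρ := by rw [dist_comm]; exact hzρ
    have hd3 : r ≤ dist (p (idx y)) (p (idx z)) := hpsep _ _ hne
    have hiy := hidx y hyW
    have hiz := hidx z hzW
    have hclose : |dist (p (idx y)) (p (idx z)) - dist y z| ≤ 2 * ε₁ := by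
      rw [abs_sub_le_iff]
      constructor
      · linarith [dist_triangle4 (p (idx y)) y z (p (idx z)), dist_comm z (p (idx z))]
      · linarith [dist_triangle4 y (p (idx y)) (p (idx z)) z, dist_comm y (p (idx y))]
    have hd4 : dist (p (idx y)) (p (idx z)) ≤ ρ + 1 := by
      linarith [(abs_sub_le_iff.1 hclose).1]
    have h := hmod _ ⟨hd3, hd4⟩ _ ⟨hd1, by linarith⟩
      (by rw [Real.dist_eq]; exact hclose.trans hε₁ε₀)
    rw [Real.dist_eq] at h
    linarith [(abs_sub_le_iff.1 h).2]
  calc ∑ z ∈ Ny, lennardJones (dist y z)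
      ≤ ∑ z ∈ Ny, (lennardJones (dist (p (idx y)) (p (idx z))) + ω) := Finset.sum_le_sum h2
    _ = ∑ z ∈ Ny, lennardJones (dist (p (idx y)) (p (idx z))) + Ny.card * ω := by
        rw [Finset.sum_add_distrib, Finset.sum_const, nsmul_eq_mul]
    _ = _ := by rw [Finset.sum_image fun a ha b hb h => hinj (hNyW ha) (hNyW hb) h]

/-- **Unmatched particles are far.** Two-way matching at tolerance `ε₁` (`4ε₁ ≤ 1`) on the ball
of radius `‖c‖ + L + ρ + 2` (`ρ ≥ 2`), matches `idx` of the window points (every point of `X`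
within `L + ρ + 1` of `c` is in the window) with the uniqueness property "a particle within `ε₁`
of a window point is its match": if `N_y` contains every point `z ≠ y` of `X` within `ρ` of the
point `y` (`dist y c ≤ L`), then a particle `k ≠ idx y` outside `idx(N_y)` is at distance
`≥ ρ/2` from `p (idx y)`. [folklore] -/
theorem far_of_not_mem_image {ρ ε₁ L : ℝ} {c : E3}
    (hB' : ∀ i : Fin N, ‖p i‖ ≤ ‖c‖ + L + ρ + 2 → ∃ s ∈ X, dist (p i) s ≤ ε₁)
    {Wf : Finset E3} (hmemW : ∀ w : E3, w ∈ X → dist w c ≤ L + ρ + 1 → w ∈ Wf)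
    {idx : E3 → Fin N} (hidx : ∀ w ∈ Wf, dist (p (idx w)) w ≤ ε₁)
    (huniq : ∀ i : Fin N, ∀ s ∈ Wf, dist (p i) s ≤ ε₁ → i = idx s)
    (hε₁4 : 4 * ε₁ ≤ 1) (hρ2 : 2 ≤ ρ)
    {y : E3} (hyL : dist y c ≤ L) (hyW : y ∈ Wf)
    {Ny : Finset E3} (hNy : ∀ z : E3, z ∈ X → z ≠ y → dist z y ≤ ρ → z ∈ Ny)
    {k : Fin N} (hky : k ≠ idx y) (hk : k ∉ Ny.image idx) :
    ρ / 2 ≤ dist (p k) (p (idx y)) := by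
  by_contra hlt
  have hlt' := not_le.1 hlt
  have hpy := hidx y hyW
  have hky' : dist (p k) y ≤ ρ / 2 + ε₁ := by
    linarith [dist_triangle (p k) (p (idx y)) y]
  have hnk : ‖p k‖ ≤ ‖c‖ + L + ρ + 2 := by
    have h := norm_le_norm_add_const_of_dist_le hky'
    have h' := norm_le_norm_add_const_of_dist_le hyL
    linarith
  obtain ⟨s, hsX, hs⟩ := hB' k hnk
  have hsy : dist s y < ρ := by
    linarith [dist_triangle4 s (p k) (p (idx y)) y, dist_comm s (p k)]
  have hsc : dist s c ≤ L + ρ + 1 := by linarith [dist_triangle s y c]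
  have hsW : s ∈ Wf := hmemW s hsX hsc
  have hks : k = idx s := huniq k s hsW hs
  have hsy' : s ≠ y := fun h => hky (by rw [hks, h])
  exact hk (Finset.mem_image.2 ⟨s, hNy s hsX hsy' hsy.le, hks.symm⟩)

/-- **The particles of the ball are the matches of the points of the ball.** If every particle
within `L + ε₁` of `c` has a point of `X` within `ε₁`, no point of `X` has its distance to `c`
in `(L, L + g]` with `2ε₁ ≤ g`, and `idx` matches the window `Wf ⊇ Yf = X ∩ B̄_L(c)` with the
uniqueness property, then `idx(Yf)` is the set of particles in `B̄_{L+ε₁}(c)`. [folklore] -/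
theorem image_eq_ball {ε₁ L g : ℝ} {c : E3}
    (hB' : ∀ i : Fin N, dist (p i) c ≤ L + ε₁ → ∃ s ∈ X, dist (p i) s ≤ ε₁)
    (hgap : ∀ s ∈ X, dist s c ≤ L + g → dist s c ≤ L) (hε₁g : 2 * ε₁ ≤ g)
    {Yf Wf : Finset E3} (hmemY : ∀ y : E3, y ∈ Yf ↔ y ∈ X ∧ dist y c ≤ L) (hYW : Yf ⊆ Wf)
    {idx : E3 → Fin N} (hidx : ∀ w ∈ Wf, dist (p (idx w)) w ≤ ε₁)
    (huniq : ∀ i : Fin N, ∀ s ∈ Wf, dist (p i) s ≤ ε₁ → i = idx s)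
    (Sb : Finset (Fin N)) (hSb : ∀ i, i ∈ Sb ↔ dist (p i) c ≤ L + ε₁) :
    Yf.image idx = Sb := by
  classical
  ext i
  simp only [Finset.mem_image, hSb]
  constructor
  · rintro ⟨y, hy, rfl⟩
    obtain ⟨-, hyL⟩ := (hmemY y).1 hy
    calc dist (p (idx y)) c ≤ dist (p (idx y)) y + dist y c := dist_triangle _ _ _
      _ ≤ ε₁ + L := add_le_add (hidx y (hYW hy)) hyL
      _ = L + ε₁ := add_comm _ _
  · intro hi
    obtain ⟨s, hsX, hs⟩ := hB' i hi
    have hsc : dist s c ≤ L + g :=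
      calc dist s c ≤ dist (p i) s + dist (p i) c := dist_triangle_left _ _ _
        _ ≤ ε₁ + (L + ε₁) := add_le_add hs hi
        _ ≤ L + g := by linarith
    have hsY : s ∈ Yf := (hmemY s).2 ⟨hsX, hgap s hsX hsc⟩
    exact ⟨s, hsY, (huniq i s (hYW hsY) hs).symm⟩

/-- **The site sum of a window point against the site energy of its match.** Under the
hypotheses of the previous lemmas (`X` and the injective configuration `p` both `r`-separated,
two-way `ε₁`-matching on the ball of radius `‖c‖ + L + ρ + 2`, the window
`Wf = {w ∈ X : dist w c ≤ L + ρ + 1}` matched by `idx` injectively with the uniqueness property,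
`ω ≥ 0` a modulus of `V_LJ` on `[r, ρ + 1]` at scale `ε₀ ≥ 2ε₁`, `4ε₁ ≤ 1`, `2 ≤ ρ`, `r ≤ ρ/2`):
for `y ∈ X` with `dist y c ≤ L`,
`Σ'_{z ∈ X, z ≠ y} V_LJ(|y − z|) ≤ 𝓔^{idx y}(p) + (2ρ/r + 1)³ ω + (1/6) · 1024/(r³ (ρ/2)³)`
(truncate at `ρ`, compare the near terms by continuity, bound the far terms of `p` by the tail).
[folklore] -/
theorem tsum_site_le_siteEnergy_add (hpinj : Function.Injective p)
    {r ρ ε₁ ε₀ ω L : ℝ} {c : E3} (hr : 0 < r)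
    (hsepX : ∀ a ∈ X, ∀ b ∈ X, a ≠ b → r ≤ dist a b)
    (hpsep : ∀ k l : Fin N, k ≠ l → r ≤ dist (p k) (p l))
    (hB' : ∀ i : Fin N, ‖p i‖ ≤ ‖c‖ + L + ρ + 2 → ∃ s ∈ X, dist (p i) s ≤ ε₁)
    (hmod : ∀ s ∈ Set.Icc r (ρ + 1), ∀ t ∈ Set.Icc r (ρ + 1), dist s t ≤ ε₀ →
      dist (lennardJones s) (lennardJones t) ≤ ω)
    (hρ2 : 2 ≤ ρ) (hρr : r ≤ ρ / 2) (hε₁ε₀ : 2 * ε₁ ≤ ε₀) (hε₁4 : 4 * ε₁ ≤ 1) (hω : 0 ≤ ω)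
    {Wf : Finset E3} (hmemW : ∀ w : E3, w ∈ Wf ↔ w ∈ X ∧ dist w c ≤ L + ρ + 1)
    {idx : E3 → Fin N} (hidx : ∀ w ∈ Wf, dist (p (idx w)) w ≤ ε₁)
    (hinj : Set.InjOn idx (Wf : Set E3))
    (huniq : ∀ i : Fin N, ∀ s ∈ Wf, dist (p i) s ≤ ε₁ → i = idx s)
    {y : E3} (hyX : y ∈ X) (hyL : dist y c ≤ L) :
    ∑' z : ↥({z : E3 | z ∈ X ∧ z ≠ y} : Set E3), lennardJones (dist y (z : E3)) ≤
      siteEnergy lennardJones p (idx y) +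
        ((2 * ρ / r + 1) ^ 3 * ω + 1 / 6 * (1024 / (r ^ 3 * (ρ / 2) ^ 3))) := by
  classical
  have hρ1 : 1 ≤ ρ := by linarith
  have hρ0 : 0 ≤ ρ := by linarith
  have hyW : y ∈ Wf := (hmemW y).2 ⟨hyX, by linarith⟩
  -- the near points of `y`
  set Ny : Finset E3 := Wf.filter fun w => w ≠ y ∧ dist w y ≤ ρ with hNy
  have hNyW : Ny ⊆ Wf := Finset.filter_subset _ _
  have hNy_iff : ∀ z : E3, z ∈ Ny ↔ z ∈ X ∧ z ≠ y ∧ dist z y ≤ ρ := by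
    intro z
    rw [hNy, Finset.mem_filter, hmemW]
    constructor
    · rintro ⟨⟨hzX, -⟩, hzy, hzρ⟩
      exact ⟨hzX, hzy, hzρ⟩
    · rintro ⟨hzX, hzy, hzρ⟩
      refine ⟨⟨hzX, ?_⟩, hzy, hzρ⟩
      calc dist z c ≤ dist z y + dist y c := dist_triangle _ _ _
        _ ≤ ρ + L := add_le_add hzρ hyL
        _ ≤ L + ρ + 1 := by linarith
  -- (a) truncation
  have h1 := tsum_site_le_sum_near hr hsepX hyX hρ1 Ny hNy_iff
  -- (b) the near count
  have hcardNy : (Ny.card : ℝ) ≤ (2 * ρ / r + 1) ^ 3 := by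
    have h := card_le_of_separated_of_dist_le Ny y hr hρ0
      (fun z hz => ((hNy_iff z).1 hz).2.2)
      (fun a ha b hb hab => hsepX a ((hNy_iff a).1 ha).1 b ((hNy_iff b).1 hb).1 hab)
    rwa [finrank_euclideanSpace_fin] at h
  -- (c) continuity
  have h3 := sum_near_le_sum_image_add hsepX hpsep hmod hε₁ε₀ (by linarith)
    (fun w hw => ((hmemW w).1 hw).1) hidx hinj hyW hNyW
    (fun z hz => ⟨((hNy_iff z).1 hz).2.1, ((hNy_iff z).1 hz).2.2⟩)
  -- (d) splitting the site energy of the match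
  have hsub : Ny.image idx ⊆ Finset.univ.erase (idx y) := by
    intro k hk
    obtain ⟨z, hz, rfl⟩ := Finset.mem_image.1 hk
    exact Finset.mem_erase.2
      ⟨fun h => ((hNy_iff z).1 hz).2.1 (hinj (hNyW hz) hyW h), Finset.mem_univ _⟩
  have hsplit : siteEnergy lennardJones p (idx y) =
      ∑ k ∈ Finset.univ.erase (idx y) \ Ny.image idx, lennardJones (dist (p (idx y)) (p k)) +
        ∑ k ∈ Ny.image idx, lennardJones (dist (p (idx y)) (p k)) := by
    unfold siteEnergy
    rw [← Finset.sum_sdiff hsub]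
  -- (e) the far particles
  have hfar : ∀ k ∈ Finset.univ.erase (idx y) \ Ny.image idx,
      ρ / 2 ≤ dist (p k) (p (idx y)) := fun k hk => by
    obtain ⟨hk1, hk2⟩ := Finset.mem_sdiff.1 hk
    exact far_of_not_mem_image hB' (fun w hwX hwc => (hmemW w).2 ⟨hwX, hwc⟩) hidx huniq hε₁4
      hρ2 hyL hyW (fun z hzX hzy hzρ => (hNy_iff z).2 ⟨hzX, hzy, hzρ⟩)
      (Finset.ne_of_mem_erase hk1) hk2
  have h5 := neg_tail_le_sum_far hpinj hr hρr hpsep (idx y) _ hfar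
  have hMω : (Ny.card : ℝ) * ω ≤ (2 * ρ / r + 1) ^ 3 * ω :=
    mul_le_mul_of_nonneg_right hcardNy hω
  linarith only [h1, h3, hsplit, h5, hMω]

end Summit.AtomisticToContinuum.Crystallization.Theorems.HullBulkOptimal

end
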